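import Summits.ResolutionOfSingularities.ResolutionOfSingularities.Theorems.RadicialJungCleanModelsLens5ArcPotential
import Summits.ResolutionOfSingularities.ResolutionOfSingularities.Theorems.RadicialJungCleanModelsLens5AbsDerivation
import HarnessLib

/-!
# Crux `DescentPerfectToAll` (stmt-ResolutionOfSingularities-0549) — STRATEGY-CENSUS-4 addendum B (res-B-lens-1 g3, 2026-08-29):
# the ONE transportable organ of the dim-3 anatomy, typed at dimension `d`

Companion of `Cruxes/DescentPerfectToAll/STRATEGY-CENSUS-4-addendum-B.md` §2 (DIM-TRANSPORT TABLE).  The wave-2/3 anatomy of the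
dim-3 slice `15917|₃` of the live line `via-clean-models` has exactly one piece whose proof does not cite a dimension-3 theorem
(CP 2019 / CJS 2020 / Piltant 2013): lens-5's THEOREM P (class (A): clean local uniformization of the `K^p`-line of `g₀` along a
zero-dimensional DISCRETE rank-one valuation), landed as `Theorems.RadicialJung.CleanModels.Lens5.ArcPotentialProof.arcPotential`
(✓p691218) + LEMMA D-abs `Lens5.AbsDerivation.absDerivation_of_forall_pow_ne'` (✓p690461).  Its only use of `dim = 3` is the r.s.p.
completion `exists_span_triple` / `exists_span_triple_of_indep` at exit (1); the frame (`exists_quadraticSeq_package`,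
`exists_mem_of_quadraticTransforms_of_discrete`) is stated in every dimension.

* `CleanLUArcAtDim p d` — THEOREM P's statement with the centre of dimension `d` (the binders of the canonical port target
  `cleanLU3DefectArc_discrete`, `3 ↦ d`); `d ≥ 4` is the rung-B-proper regime (imperfect ground fields allowed).
* `cleanLUArcAtDim_three` — sanity: the `d = 3` instance IS the landed theorem (kernel-checked specialisation, no sorry).
* `CleanLUArcAllDim p` — the recommended (LOW-priority, counted-0) dim-free support target «THEOREM P_d for every d».
* `RSOPCompletionAtDim d` — the transport lemma (r.s.p. completion of an independent pair in dimension d), statement only, size S (rev 2).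

Honest framing: this is LU-currency for ONE (the easy, discrete) valuation class; by the census it is strategically inert for rung B
(no patching theorem in dimension ≥ 4 turns clean LU into `CleanModels`).  Nothing here proves resolution of singularities in
characteristic `p`; `CleanLUArcAtDim p d` for `d ≥ 4` is NOT proved here (statement only).  [OURS · CANDIDATE] counted 0.
-/

noncomputable section

set_option linter.dupNamespace false

open IsLocalRing
open Literature.AlgebraicGeometry.Resolution
open Summit.ResolutionOfSingularities.ResolutionOfSingularities.Theorems.RadicialJung.CleanModels

namespace Summit.ResolutionOfSingularities.ResolutionOfSingularities.Cruxes.DescentPerfectToAll.Census5DimTransport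

/-- THEOREM P at centre dimension `d` (statement; `d = 3` is ✓p691218 + ✓p690461, `d ≥ 4` OPEN-but-transportable, size S–M:
replace `exists_span_triple(_of_indep)` by an r.s.p. completion of the pair `(π, F)` in a regular local ring of dimension `d`). [folklore] -/
def CleanLUArcAtDim (p d : ℕ) : Prop :=
    ∀ (k : Type) [Field k] [CharP k p] (K : Type) [Field K] [Algebra k K]
    (O : ValuationSubring K) (A : Subalgebra k K), A.toSubring ≤ O.toSubring → A.FG → IsFractionRing A K →
    ringKrullDim A ≤ (d : WithBot ℕ∞) → IsRegularLocalRing (locAtCentre A.toSubring O) →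
    ringKrullDim (locAtCentre A.toSubring O) = (d : WithBot ℕ∞) →
    (∀ (T : Subring K) (hT : T ≤ O.toSubring), A.toSubring ≤ T → (subringCentre T O hT).IsMaximal) →
    ∀ g₀ : K, (∀ c : K, c ^ p ≠ g₀) →
    (∀ f₀ : K, ∃ f₁ : K, O.valuation (g₀ - f₁ ^ p) < O.valuation (g₀ - f₀ ^ p)) →
    (∀ hk : ∀ c : k, algebraMap k K c ∈ O, transcendenceDefect k O hk ≠ 0) →
    (∃ π : K, π ≠ 0 ∧ (∀ x : K, O.valuation x < 1 → O.valuation x ≤ O.valuation π) ∧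
      (∀ x : K, x ≠ 0 → ∃ n : ℕ, O.valuation π ^ n ≤ O.valuation x)) →
    ∃ (A' : Subalgebra k K), A'.toSubring ≤ O.toSubring ∧ A ≤ A' ∧ A'.FG ∧
    ∃ (_ : IsRegularLocalRing (locAtCentre A'.toSubring O)) (c : Fin p → K), (∃ j : Fin p, (j : ℕ) ≠ 0 ∧ c j ≠ 0) ∧
    ((∃ (d m : ℕ) (hmd : m ≤ d) (t : Fin d → ↥(locAtCentre A'.toSubring O)) (a : Fin m → ℕ) (u : ↥(locAtCentre A'.toSubring O)), IsUnit u ∧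
    Ideal.span (Set.range t) = IsLocalRing.maximalIdeal ↥(locAtCentre A'.toSubring O) ∧
    ringKrullDim ↥(locAtCentre A'.toSubring O) = (d : WithBot ℕ∞) ∧ 0 < m ∧ (∀ i, ¬ p ∣ a i) ∧
    (∑ j : Fin p, c j ^ p * g₀ ^ (j : ℕ)) = (u : K) * ∏ i : Fin m, ((t (Fin.castLE hmd i) : ↥(locAtCentre A'.toSubring O)) : K) ^ (a i)) ∨
    (∃ u : ↥(locAtCentre A'.toSubring O), IsUnit u ∧ (∑ j : Fin p, c j ^ p * g₀ ^ (j : ℕ)) = (u : K) ∧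
    ∀ c' : ↥(locAtCentre A'.toSubring O), u - c' ^ p ∉ IsLocalRing.maximalIdeal ↥(locAtCentre A'.toSubring O)) ∨
    (∃ s c' : ↥(locAtCentre A'.toSubring O), (∑ j : Fin p, c j ^ p * g₀ ^ (j : ℕ)) = (s : K) ∧
    s - c' ^ p ∈ IsLocalRing.maximalIdeal ↥(locAtCentre A'.toSubring O) ∧
    s - c' ^ p ∉ IsLocalRing.maximalIdeal ↥(locAtCentre A'.toSubring O) ^ 2))

/-- The TRANSPORT LEMMA of row 2 (replaces `exists_span_triple` + `exists_span_triple_of_indep` of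
`…Lens5ArcPotentialBricks.lean` :213/:240 in dimension `d`): in a Noetherian regular local ring of dimension `d ≥ 2`, a pair `(π, F)` with
`π ∈ 𝔪 ∖ 𝔪²`, `F ∈ 𝔪`, independent modulo `𝔪²`, extends to a regular system of parameters `t : Fin d → S` with `t 0 = π`, `t 1 = F`.
Statement only (size S: `IsRegularLocalRing.spanFinrank_maximalIdeal` + Nakayama on `𝔪/𝔪²`); an idle-prover target, counted 0. [folklore] -/
def RSOPCompletionAtDim (d : ℕ) : Prop :=
    ∀ (S : Type) [CommRing S] [IsLocalRing S] [IsNoetherianRing S], IsRegularLocalRing S →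
    ringKrullDim S = (d : WithBot ℕ∞) → 2 ≤ d →
    ∀ π F : S, π ∈ maximalIdeal S → π ∉ maximalIdeal S ^ 2 → F ∈ maximalIdeal S →
    (∀ a b : S, a * π + b * F ∈ maximalIdeal S ^ 2 → b ∈ maximalIdeal S) →
    ∃ t : Fin d → S, (∀ h0 : 0 < d, t ⟨0, h0⟩ = π) ∧ (∀ h1 : 1 < d, t ⟨1, h1⟩ = F) ∧
      Ideal.span (Set.range t) = maximalIdeal S

/-- The dim-free support target recommended (low priority, counted 0) by census-4 addendum B §3: THEOREM P in every dimension. -/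
def CleanLUArcAllDim (p : ℕ) : Prop := ∀ d : ℕ, CleanLUArcAtDim p d

/-- SANITY (kernel): at `d = 3` the statement is exactly lens-5's THEOREM P + LEMMA D-abs as landed by the lead
(`Lens5.ArcPotentialProof.arcPotential` ✓p691218, `Lens5.AbsDerivation.absDerivation_of_forall_pow_ne'` ✓p690461). [folklore] -/
theorem cleanLUArcAtDim_three (p : ℕ) (hp : p.Prime) : CleanLUArcAtDim p 3 := by
  intro k _ _ K _ _ O A hAO hfg hfrac hdimA hreg hdim hzd g₀ hg hna htd hπ
  have hdimA' : ringKrullDim A ≤ 3 := by simpa using hdimA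
  have hdim' : ringKrullDim (locAtCentre A.toSubring O) = 3 := by simpa using hdim
  exact Lens5.ArcPotentialProof.arcPotential p hp k K O A hAO hfg hfrac hdimA' hreg hdim' hzd g₀ hg hna htd hπ
    (Lens5.AbsDerivation.absDerivation_of_forall_pow_ne' p hp k K A hfg hfrac g₀ hg)

end Summit.ResolutionOfSingularities.ResolutionOfSingularities.Cruxes.DescentPerfectToAll.Census5DimTransport

end
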